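import Summits.AtomisticToContinuum.FouriersLaw.Theorems.OddSectorIrreversibilityResponseDensityBackward

/-!
# The backward identity for Gibbs-weighted pairings of the pinned chain: removing the truncation

Helper file for item stmt-AtomisticToContinuum-9144 (`ResponseDensity`, route
`OddSectorIrreversibility`, sub-problem `FouriersLaw` of `AtomisticToContinuum`).

Dominated-convergence inputs for passing `R → ∞` in the truncated backward identity
(`…ResponseDensityBackward.lean`): the diagonal term and the left-hand side. No definitions.
-/

noncomputable section

open MeasureTheory ProbabilityTheory Filter Topology Set
open scoped NNReal ENNReal ContDiff

namespace Summit.AtomisticToContinuum.FouriersLaw.Theorems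

open Literature.MathematicalPhysics.KineticTheory.HeatConduction
open Literature.Probability.Process Literature.MathematicalPhysics.KineticTheory OscillatorChain

variable {N : ℕ}

section CutoffObservable

variable {ω₂ lam β γ : ℝ} (hω : 0 < ω₂) (hl : 0 ≤ lam) (hβ : 0 ≤ β)
  {φ : PhaseSpace N → ℝ} (hφc : Continuous φ)
include hω hl hβ

omit hω hl hβ in
/-- The truncated observable `χ(H/R) φ` is continuous. -/
theorem continuous_cutoff_mul (γ : ℝ) (hφc : Continuous φ) (R : ℝ) :
    Continuous fun y : PhaseSpace N =>
      smoothCutoff ((pinnedChain ω₂ lam β γ).hamiltonian N y / R) * φ y :=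
  ((contDiff_smoothCutoff (n := 0)).continuous.comp
    ((pinnedChain_contDiff_hamiltonian ω₂ lam β γ N (n := 0)).continuous.div_const R)).mul hφc

/-- The truncated observable `χ(H/R) φ` has compact support (`R > 0`). -/
theorem hasCompactSupport_cutoff_mul (γ : ℝ) (φ : PhaseSpace N → ℝ) {R : ℝ} (hR : 0 < R) :
    HasCompactSupport fun y : PhaseSpace N =>
      smoothCutoff ((pinnedChain ω₂ lam β γ).hamiltonian N y / R) * φ y := by
  refine HasCompactSupport.intro (pinnedChain_isCompact_setOf_hamiltonian_le hω hl hβ γ N (2 * R))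
    fun y hy => ?_
  simp only [Set.mem_setOf_eq, not_le] at hy
  rw [smoothCutoff_of_two_le ((le_div_iff₀ hR).2 hy.le), zero_mul]

include hφc in
/-- The truncated observable is bounded. -/
theorem exists_bound_cutoff_mul (γ : ℝ) {R : ℝ} (hR : 0 < R) :
    ∃ B : ℝ, ∀ y : PhaseSpace N,
      ‖smoothCutoff ((pinnedChain ω₂ lam β γ).hamiltonian N y / R) * φ y‖ ≤ B :=
  (continuous_cutoff_mul γ hφc R).bounded_above_of_compact_support
    (hasCompactSupport_cutoff_mul hω hl hβ γ φ hR)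

include hφc in
/-- The forecast of the truncated observable is continuous in the starting point (Feller). -/
theorem continuous_integral_cutoff_kernel {γ : ℝ} (hγ : 0 ≤ γ) (T_L T_R : ℝ) (t : ℝ≥0)
    {R : ℝ} (hR : 0 < R) :
    Continuous fun x : PhaseSpace N =>
      ∫ y, smoothCutoff ((pinnedChain ω₂ lam β γ).hamiltonian N y / R) * φ y
        ∂((pinnedChain ω₂ lam β γ).transitionKernel N T_L T_R t x) := by
  obtain ⟨B, hB⟩ := exists_bound_cutoff_mul hω hl hβ hφc γ hR
  exact pinnedChain_continuous_integral_transitionKernel hω hl hβ hγ N T_L T_R t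
    (continuous_cutoff_mul γ hφc R) hB

/-- `e^{cH}` is Lebesgue-integrable on phase space for `c < 0`. -/
theorem integrable_exp_mul_hamiltonian (γ : ℝ) {c : ℝ} (hc : c < 0) :
    Integrable fun x : PhaseSpace N => Real.exp (c * (pinnedChain ω₂ lam β γ).hamiltonian N x) := by
  have h := pinnedChain_integrable_exp_neg_mul_hamiltonian hω hl hβ γ N (c := -c) (by linarith)
  refine h.congr (Eventually.of_forall fun x => ?_)
  simp only [neg_mul, neg_neg]

/-- `(1 + p_0² + p_{N-1}²) e^{cH}` is Lebesgue-integrable on phase space for `c < 0` (`N ≥ 1`). -/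
theorem integrable_momentSq_mul_exp_mul_hamiltonian (γ : ℝ) (hN : 0 < N) {c : ℝ} (hc : c < 0) :
    Integrable fun x : PhaseSpace N =>
      (1 + x.2 ⟨0, hN⟩ ^ 2 + x.2 ⟨N - 1, by omega⟩ ^ 2) *
        Real.exp (c * (pinnedChain ω₂ lam β γ).hamiltonian N x) := by
  set Hm := (pinnedChain ω₂ lam β γ).hamiltonian N with hHm
  have hε : 0 < -c / 2 := by linarith
  have hint := integrable_exp_mul_hamiltonian hω hl hβ γ (N := N) (c := c / 2) (by linarith)
  have hHc : Continuous Hm := (pinnedChain_contDiff_hamiltonian ω₂ lam β γ N (n := 0)).continuous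
  have hmeas : Continuous fun x : PhaseSpace N =>
      (1 + x.2 ⟨0, hN⟩ ^ 2 + x.2 ⟨N - 1, by omega⟩ ^ 2) * Real.exp (c * Hm x) := by
    refine Continuous.mul ?_ (Real.continuous_exp.comp (continuous_const.mul hHc))
    exact (continuous_const.add (((continuous_apply _).comp continuous_snd).pow 2)).add
      (((continuous_apply _).comp continuous_snd).pow 2)
  refine (hint.const_mul (1 + 4 * (2 / -c))).mono' hmeas.aestronglyMeasurable
    (Eventually.of_forall fun x => ?_)
  have hH0 : 0 ≤ Hm x := pinnedChain_hamiltonian_nonneg hω.le hl hβ γ N x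
  -- `p_0² + p_{N-1}² ≤ 2 ∑ p_i²/2 ≤ 2H ≤ 2 · e^{(-c/2)H}/(-c/2)`
  have hkin : ∑ i, x.2 i ^ 2 / 2 ≤ Hm x :=
    (pinnedChain ω₂ lam β γ).kinetic_le_hamiltonian_of_nonneg
      (fun q => by show 0 ≤ ω₂ * q ^ 2 / 2 + lam * q ^ 4 / 4; positivity)
      (fun r => by show 0 ≤ r ^ 2 / 2 + β * r ^ 4 / 4; positivity) N x
  have hp0 : x.2 ⟨0, hN⟩ ^ 2 / 2 ≤ ∑ i, x.2 i ^ 2 / 2 :=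
    Finset.single_le_sum (f := fun i => x.2 i ^ 2 / 2) (fun i _ => by positivity) (Finset.mem_univ _)
  have hpl : x.2 ⟨N - 1, by omega⟩ ^ 2 / 2 ≤ ∑ i, x.2 i ^ 2 / 2 :=
    Finset.single_le_sum (f := fun i => x.2 i ^ 2 / 2) (fun i _ => by positivity) (Finset.mem_univ _)
  have hHexp : (-c / 2) * Hm x ≤ Real.exp ((-c / 2) * Hm x) := by
    have := Real.add_one_le_exp ((-c / 2) * Hm x)
    linarith
  have hHle : Hm x ≤ (2 / -c) * Real.exp ((-c / 2) * Hm x) := by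
    rw [div_mul_eq_mul_div, le_div_iff₀ (by linarith : (0:ℝ) < -c)]
    nlinarith
  have hsum : 1 + x.2 ⟨0, hN⟩ ^ 2 + x.2 ⟨N - 1, by omega⟩ ^ 2 ≤
      1 + 4 * (2 / -c) * Real.exp ((-c / 2) * Hm x) := by linarith
  have hE : 0 < Real.exp (c * Hm x) := Real.exp_pos _
  have hE1 : 1 ≤ Real.exp ((-c / 2) * Hm x) := Real.one_le_exp (by nlinarith)
  rw [Real.norm_eq_abs, abs_of_nonneg (by positivity)]
  calc (1 + x.2 ⟨0, hN⟩ ^ 2 + x.2 ⟨N - 1, by omega⟩ ^ 2) * Real.exp (c * Hm x)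
      ≤ (1 + 4 * (2 / -c) * Real.exp ((-c / 2) * Hm x)) * Real.exp (c * Hm x) :=
        mul_le_mul_of_nonneg_right hsum hE.le
    _ ≤ ((1 + 4 * (2 / -c)) * Real.exp ((-c / 2) * Hm x)) * Real.exp (c * Hm x) := by
        refine mul_le_mul_of_nonneg_right ?_ hE.le
        have h22 : 0 ≤ 4 * (2 / -c) := by
          have := div_pos (by norm_num : (0:ℝ) < 2) (by linarith : (0:ℝ) < -c)
          linarith
        nlinarith
    _ = (1 + 4 * (2 / -c)) * Real.exp (c / 2 * Hm x) := by
        rw [mul_assoc, ← Real.exp_add]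
        congr 1
        ring_nf

end CutoffObservable

section Limits

variable {ω₂ lam β γ : ℝ} (hω : 0 < ω₂) (hl : 0 ≤ lam) (hβ : 0 ≤ β) (hγ : 0 < γ)
  (hN : 0 < N) {T_L T_R : ℝ} (hTL : 0 < T_L) (hTR : 0 < T_R)
  {ϑ : ℝ} (hϑ : 0 < ϑ) (hϑ' : ϑ < 1 / max T_L T_R) {θ : ℝ} (hθϑ : θ + ϑ < 0)
  {φ : PhaseSpace N → ℝ} (hφc : Continuous φ) {C : ℝ}
  (hφ : ∀ y, |φ y| ≤ C * Real.exp (ϑ * (pinnedChain ω₂ lam β γ).hamiltonian N y))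
include hω hl hβ hθϑ hφc hφ

/-- **Limit of the diagonal term**: `∫ χ_R e^{θH} χ_R φ dx → ∫ e^{θH} φ dx` (`R = n + 1 → ∞`). -/
theorem tendsto_integral_cutoff_diag :
    Tendsto (fun n : ℕ => ∫ x, (smoothCutoff ((pinnedChain ω₂ lam β γ).hamiltonian N x / (n + 1)) *
        Real.exp (θ * (pinnedChain ω₂ lam β γ).hamiltonian N x)) *
        (smoothCutoff ((pinnedChain ω₂ lam β γ).hamiltonian N x / (n + 1)) * φ x))
      atTop (𝓝 (∫ x, Real.exp (θ * (pinnedChain ω₂ lam β γ).hamiltonian N x) * φ x)) := by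
  set Hm := (pinnedChain ω₂ lam β γ).hamiltonian N with hHm
  have hHc : Continuous Hm := (pinnedChain_contDiff_hamiltonian ω₂ lam β γ N (n := 0)).continuous
  have hsc : Continuous smoothCutoff := (contDiff_smoothCutoff (n := 0)).continuous
  have hC : 0 ≤ C := by
    have := (abs_nonneg _).trans (hφ 0)
    exact nonneg_of_mul_nonneg_left this (Real.exp_pos _)
  refine tendsto_integral_of_dominated_convergence (fun x => C * Real.exp ((θ + ϑ) * Hm x))
    (fun n => ?_) ((integrable_exp_mul_hamiltonian hω hl hβ γ hθϑ).const_mul C)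
    (fun n => Eventually.of_forall fun x => ?_) (Eventually.of_forall fun x => ?_)
  · exact (((hsc.comp (hHc.div_const _)).mul (Real.continuous_exp.comp (continuous_const.mul hHc))).mul
      ((hsc.comp (hHc.div_const _)).mul hφc)).aestronglyMeasurable
  · rw [Real.norm_eq_abs, abs_mul, add_mul, Real.exp_add]
    calc |smoothCutoff (Hm x / (n + 1)) * Real.exp (θ * Hm x)| * |smoothCutoff (Hm x / (n + 1)) * φ x|
        ≤ Real.exp (θ * Hm x) * (C * Real.exp (ϑ * Hm x)) := by
          refine mul_le_mul (abs_cutoffExp_le θ _ _) ?_ (abs_nonneg _) (Real.exp_pos _).le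
          rw [abs_mul, abs_of_nonneg (smoothCutoff_nonneg _)]
          calc smoothCutoff (Hm x / (n + 1)) * |φ x| ≤ 1 * |φ x| :=
                mul_le_mul_of_nonneg_right (smoothCutoff_le_one _) (abs_nonneg _)
            _ = |φ x| := one_mul _
            _ ≤ C * Real.exp (ϑ * Hm x) := hφ x
      _ = C * (Real.exp (θ * Hm x) * Real.exp (ϑ * Hm x)) := by ring
  · refine tendsto_const_nhds.congr' ?_
    obtain ⟨n₀, hn₀⟩ := exists_nat_ge (Hm x)
    filter_upwards [eventually_ge_atTop n₀] with n hn
    have hlt : Hm x < n + 1 := by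
      calc Hm x ≤ n₀ := hn₀
        _ ≤ n := by exact_mod_cast hn
        _ < n + 1 := lt_add_one _
    rw [cutoffExp_of_lt θ (by positivity) hlt, smoothCutoff_of_le_one ((div_le_one (by positivity)).2 hlt.le),
      one_mul]

include hγ hN hTL hTR hϑ hϑ' in
/-- **Limit of the left-hand side**: `∫ χ_R e^{θH} P_t(χ_R φ) dx → ∫ e^{θH} P_t φ dx`
(`R = n + 1 → ∞`). -/
theorem tendsto_integral_cutoff_lhs (t : ℝ≥0) :
    Tendsto (fun n : ℕ => ∫ x, (smoothCutoff ((pinnedChain ω₂ lam β γ).hamiltonian N x / (n + 1)) *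
        Real.exp (θ * (pinnedChain ω₂ lam β γ).hamiltonian N x)) *
        ∫ y, smoothCutoff ((pinnedChain ω₂ lam β γ).hamiltonian N y / (n + 1)) * φ y
          ∂((pinnedChain ω₂ lam β γ).transitionKernel N T_L T_R t x))
      atTop (𝓝 (∫ x, Real.exp (θ * (pinnedChain ω₂ lam β γ).hamiltonian N x) *
        ∫ y, φ y ∂((pinnedChain ω₂ lam β γ).transitionKernel N T_L T_R t x))) := by
  set Hm := (pinnedChain ω₂ lam β γ).hamiltonian N with hHm
  have hHc : Continuous Hm := (pinnedChain_contDiff_hamiltonian ω₂ lam β γ N (n := 0)).continuous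
  have hsc : Continuous smoothCutoff := (contDiff_smoothCutoff (n := 0)).continuous
  have hC : 0 ≤ C := by
    have := (abs_nonneg _).trans (hφ 0)
    exact nonneg_of_mul_nonneg_left this (Real.exp_pos _)
  set M : ℝ := C * Real.exp (ϑ * γ * (T_L + T_R) * t) with hM
  refine tendsto_integral_of_dominated_convergence (fun x => M * Real.exp ((θ + ϑ) * Hm x))
    (fun n => ?_) ((integrable_exp_mul_hamiltonian hω hl hβ γ hθϑ).const_mul M)
    (fun n => Eventually.of_forall fun x => ?_) (Eventually.of_forall fun x => ?_)
  · exact (((hsc.comp (hHc.div_const _)).mul (Real.continuous_exp.comp (continuous_const.mul hHc))).mul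
      (continuous_integral_cutoff_kernel hω hl hβ hφc hγ.le T_L T_R t
        (by positivity : (0:ℝ) < n + 1))).aestronglyMeasurable
  · have hin := pinnedChain_abs_integral_kernel_le hω hl hβ hγ hN hTL hTR hϑ hϑ' hφ t x
      (g := fun y => smoothCutoff (Hm y / (n + 1))) (fun y => by
        rw [abs_of_nonneg (smoothCutoff_nonneg _)]; exact smoothCutoff_le_one _)
    rw [Real.norm_eq_abs, abs_mul, add_mul, Real.exp_add]
    calc |smoothCutoff (Hm x / (n + 1)) * Real.exp (θ * Hm x)| *
          |∫ y, smoothCutoff (Hm y / (n + 1)) * φ y ∂((pinnedChain ω₂ lam β γ).transitionKernel N T_L T_R t x)|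
        ≤ Real.exp (θ * Hm x) * (C * (Real.exp (ϑ * γ * (T_L + T_R) * t) * Real.exp (ϑ * Hm x))) :=
          mul_le_mul (abs_cutoffExp_le θ _ _) hin (abs_nonneg _) (Real.exp_pos _).le
      _ = M * (Real.exp (θ * Hm x) * Real.exp (ϑ * Hm x)) := by rw [hM]; ring
  · have h1 : Tendsto (fun n : ℕ => smoothCutoff (Hm x / (n + 1)) * Real.exp (θ * Hm x)) atTop
        (𝓝 (Real.exp (θ * Hm x))) := by
      refine tendsto_const_nhds.congr' ?_
      obtain ⟨n₀, hn₀⟩ := exists_nat_ge (Hm x)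
      filter_upwards [eventually_ge_atTop n₀] with n hn
      have hlt : Hm x < n + 1 := by
        calc Hm x ≤ n₀ := hn₀
          _ ≤ n := by exact_mod_cast hn
          _ < n + 1 := lt_add_one _
      rw [cutoffExp_of_lt θ (by positivity) hlt]
    exact h1.mul (pinnedChain_tendsto_integral_cutoff_kernel hω hl hβ hγ hN hTL hTR hϑ hϑ' hφc hφ t x)


omit hθϑ hφc in
include hγ hN hTL hTR hϑ hϑ' in
/-- **Uniform majorant of the generator-pairing integrand**: for all `n`, `s ≥ 0`, `x`,
`|P_s(χ_R φ)(x) · L̂(χ_R e^{θH})(x)| ≤ K e^{ϑγ(T_L+T_R)s} (1 + p_0² + p_{N-1}²) e^{(θ+ϑ)H(x)}`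
(`R = n + 1`). -/
theorem exists_bound_cutoff_gen :
    ∃ K : ℝ, 0 ≤ K ∧ ∀ (n : ℕ) (s : ℝ≥0) (x : PhaseSpace N),
      |(∫ y, smoothCutoff ((pinnedChain ω₂ lam β γ).hamiltonian N y / (n + 1)) * φ y
            ∂((pinnedChain ω₂ lam β γ).transitionKernel N T_L T_R s x)) *
          sdeGenerator (fun y => -(pinnedChain ω₂ lam β γ).drift N y)
            ((pinnedChain ω₂ lam β γ).bathVecL N T_L) ((pinnedChain ω₂ lam β γ).bathVecR N T_R)
            (fun y => smoothCutoff ((pinnedChain ω₂ lam β γ).hamiltonian N y / (n + 1)) *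
              Real.exp (θ * (pinnedChain ω₂ lam β γ).hamiltonian N y)) x| ≤
        K * Real.exp (ϑ * γ * (T_L + T_R) * s) *
          ((1 + x.2 ⟨0, hN⟩ ^ 2 + x.2 ⟨N - 1, by omega⟩ ^ 2) *
            Real.exp ((θ + ϑ) * (pinnedChain ω₂ lam β γ).hamiltonian N x)) := by
  set P := pinnedChain ω₂ lam β γ with hP
  set Hm := P.hamiltonian N with hHm
  have hH2 : ContDiff ℝ 2 Hm := pinnedChain_contDiff_hamiltonian ω₂ lam β γ N
  have hγ' : 0 ≤ P.γ := hγ.le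
  have hC : 0 ≤ C := by
    have := (abs_nonneg _).trans (hφ 0)
    exact nonneg_of_mul_nonneg_left this (Real.exp_pos _)
  obtain ⟨S₁, hS₁0, hS₁⟩ := exists_bound_deriv_smoothCutoff
  obtain ⟨S₂, hS₂0, hS₂⟩ := exists_bound_deriv_deriv_smoothCutoff
  set A₁ : ℝ := S₁ + |θ| with hA₁
  set A₂ : ℝ := S₂ + 2 * S₁ * |θ| + θ ^ 2 with hA₂
  have hA : 0 ≤ A₁ + A₂ := by positivity
  refine ⟨C * (P.γ * ((A₁ + A₂) * (T_L + T_R + 2))), by positivity, fun n s x => ?_⟩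
  have hR1 : (1 : ℝ) ≤ n + 1 := by simp
  have hGnb : |sdeGenerator (fun y => -P.drift N y) (P.bathVecL N T_L) (P.bathVecR N T_R)
        (fun y => smoothCutoff (Hm y / (n + 1)) * Real.exp (θ * Hm y)) x| ≤
      P.γ * ((A₁ + A₂) * (T_L + T_R + 2) * (1 + x.2 ⟨0, hN⟩ ^ 2 + x.2 ⟨N - 1, by omega⟩ ^ 2) *
        Real.exp (θ * Hm x)) :=
    abs_sdeGenerator_negDrift_comp_hamiltonian_le P hN hγ' hTL.le hTR.le hH2
      ((contDiff_cutoffExp θ (n + 1)).of_le (by norm_cast)) (hasDerivAt_cutoffExp θ (n + 1))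
      (hasDerivAt_deriv_cutoffExp θ (n + 1)) x (abs_deriv_cutoffExp_le θ hS₁ hR1 _)
      (abs_deriv_deriv_cutoffExp_le θ hS₁ hS₂ hR1 _)
  have hin := pinnedChain_abs_integral_kernel_le hω hl hβ hγ hN hTL hTR hϑ hϑ' hφ s x
    (g := fun y => smoothCutoff (Hm y / (n + 1))) (fun y => by
      rw [abs_of_nonneg (smoothCutoff_nonneg _)]; exact smoothCutoff_le_one _)
  rw [abs_mul]
  calc |∫ y, smoothCutoff (Hm y / (n + 1)) * φ y ∂(P.transitionKernel N T_L T_R s x)| *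
        |sdeGenerator (fun y => -P.drift N y) (P.bathVecL N T_L) (P.bathVecR N T_R)
          (fun y => smoothCutoff (Hm y / (n + 1)) * Real.exp (θ * Hm y)) x|
      ≤ (C * (Real.exp (ϑ * γ * (T_L + T_R) * s) * Real.exp (ϑ * Hm x))) *
        (P.γ * ((A₁ + A₂) * (T_L + T_R + 2) * (1 + x.2 ⟨0, hN⟩ ^ 2 + x.2 ⟨N - 1, by omega⟩ ^ 2) *
          Real.exp (θ * Hm x))) :=
        mul_le_mul hin hGnb (abs_nonneg _) (by positivity)
    _ = C * (P.γ * ((A₁ + A₂) * (T_L + T_R + 2))) * Real.exp (ϑ * γ * (T_L + T_R) * s) *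
        ((1 + x.2 ⟨0, hN⟩ ^ 2 + x.2 ⟨N - 1, by omega⟩ ^ 2) * Real.exp ((θ + ϑ) * Hm x)) := by
        rw [show (θ + ϑ) * Hm x = θ * Hm x + ϑ * Hm x by ring, Real.exp_add]; ring

include hγ hN hTL hTR hϑ hϑ' in
/-- **Limit of the generator pairing at a fixed time** `s ≥ 0`:
`∫ P_s(χ_R φ) · L̂(χ_R e^{θH}) dx → ∫ P_s φ · L̂(e^{θH}) dx` (`R = n + 1 → ∞`), where
`L̂(e^{θH}) = γ e^{θH} (T_L (θ² p_0² + θ) + θ p_0² + T_R (θ² p_{N-1}² + θ) + θ p_{N-1}²)`. -/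
theorem tendsto_integral_cutoff_gen (s : ℝ≥0) :
    Tendsto (fun n : ℕ => ∫ x,
        (∫ y, smoothCutoff ((pinnedChain ω₂ lam β γ).hamiltonian N y / (n + 1)) * φ y
            ∂((pinnedChain ω₂ lam β γ).transitionKernel N T_L T_R s x)) *
          sdeGenerator (fun y => -(pinnedChain ω₂ lam β γ).drift N y)
            ((pinnedChain ω₂ lam β γ).bathVecL N T_L) ((pinnedChain ω₂ lam β γ).bathVecR N T_R)
            (fun y => smoothCutoff ((pinnedChain ω₂ lam β γ).hamiltonian N y / (n + 1)) *
              Real.exp (θ * (pinnedChain ω₂ lam β γ).hamiltonian N y)) x)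
      atTop (𝓝 (∫ x, (∫ y, φ y ∂((pinnedChain ω₂ lam β γ).transitionKernel N T_L T_R s x)) *
        (Real.exp (θ * (pinnedChain ω₂ lam β γ).hamiltonian N x) *
          (γ * (T_L * (θ ^ 2 * x.2 ⟨0, hN⟩ ^ 2 + θ) + θ * x.2 ⟨0, hN⟩ ^ 2 +
            (T_R * (θ ^ 2 * x.2 ⟨N - 1, by omega⟩ ^ 2 + θ) + θ * x.2 ⟨N - 1, by omega⟩ ^ 2)))))) := by
  set P := pinnedChain ω₂ lam β γ with hP
  set Hm := P.hamiltonian N with hHm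
  have hH2 : ContDiff ℝ 2 Hm := pinnedChain_contDiff_hamiltonian ω₂ lam β γ N
  have hU : ContDiff ℝ ∞ P.U := pinnedChain_contDiff_U ω₂ lam β γ
  have hV : ContDiff ℝ ∞ P.V := pinnedChain_contDiff_V ω₂ lam β γ
  have hY'c : Continuous fun y => -P.drift N y := (P.contDiff_drift hU hV N).continuous.neg
  have hLT : 0 ≤ P.γ * T_L := mul_nonneg hγ.le hTL.le
  have hRT : 0 ≤ P.γ * T_R := mul_nonneg hγ.le hTR.le
  -- closed form of the truncated generator
  have hGn : ∀ (n : ℕ) (x : PhaseSpace N),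
      sdeGenerator (fun y => -P.drift N y) (P.bathVecL N T_L) (P.bathVecR N T_R)
        (fun y => smoothCutoff (Hm y / (n + 1)) * Real.exp (θ * Hm y)) x =
      P.γ * ((T_L * ((deriv (deriv smoothCutoff) (Hm x / (n + 1)) / (n + 1) ^ 2 * Real.exp (θ * Hm x) +
          2 * (deriv smoothCutoff (Hm x / (n + 1)) / (n + 1)) * (θ * Real.exp (θ * Hm x)) +
          smoothCutoff (Hm x / (n + 1)) * (θ ^ 2 * Real.exp (θ * Hm x))) * x.2 ⟨0, hN⟩ ^ 2 +
          (deriv smoothCutoff (Hm x / (n + 1)) / (n + 1) * Real.exp (θ * Hm x) +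
            smoothCutoff (Hm x / (n + 1)) * (θ * Real.exp (θ * Hm x)))) +
          (deriv smoothCutoff (Hm x / (n + 1)) / (n + 1) * Real.exp (θ * Hm x) +
            smoothCutoff (Hm x / (n + 1)) * (θ * Real.exp (θ * Hm x))) * x.2 ⟨0, hN⟩ ^ 2) +
        (T_R * ((deriv (deriv smoothCutoff) (Hm x / (n + 1)) / (n + 1) ^ 2 * Real.exp (θ * Hm x) +
          2 * (deriv smoothCutoff (Hm x / (n + 1)) / (n + 1)) * (θ * Real.exp (θ * Hm x)) +
          smoothCutoff (Hm x / (n + 1)) * (θ ^ 2 * Real.exp (θ * Hm x))) * x.2 ⟨N - 1, by omega⟩ ^ 2 +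
          (deriv smoothCutoff (Hm x / (n + 1)) / (n + 1) * Real.exp (θ * Hm x) +
            smoothCutoff (Hm x / (n + 1)) * (θ * Real.exp (θ * Hm x)))) +
          (deriv smoothCutoff (Hm x / (n + 1)) / (n + 1) * Real.exp (θ * Hm x) +
            smoothCutoff (Hm x / (n + 1)) * (θ * Real.exp (θ * Hm x))) * x.2 ⟨N - 1, by omega⟩ ^ 2)) :=
    fun n x => sdeGenerator_negDrift_comp_hamiltonian P hN hLT hRT hH2
      ((contDiff_cutoffExp θ (n + 1)).of_le (by norm_cast)) (hasDerivAt_cutoffExp θ (n + 1))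
      (hasDerivAt_deriv_cutoffExp θ (n + 1)) x
  obtain ⟨K, hK0, hK⟩ := exists_bound_cutoff_gen hω hl hβ hγ hN hTL hTR hϑ hϑ' hφ (θ := θ)
  -- dominated convergence
  set M : ℝ := K * Real.exp (ϑ * γ * (T_L + T_R) * s) with hM
  refine tendsto_integral_of_dominated_convergence
    (fun x => M * ((1 + x.2 ⟨0, hN⟩ ^ 2 + x.2 ⟨N - 1, by omega⟩ ^ 2) * Real.exp ((θ + ϑ) * Hm x)))
    (fun n => ?_) ((integrable_momentSq_mul_exp_mul_hamiltonian hω hl hβ γ hN hθϑ).const_mul M)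
    (fun n => Eventually.of_forall fun x => ?_) (Eventually.of_forall fun x => ?_)
  · exact ((continuous_integral_cutoff_kernel hω hl hβ hφc hγ.le T_L T_R s
      (by positivity : (0:ℝ) < n + 1)).mul (continuous_sdeGenerator _ _ hY'c
        (contDiff_cutoffExp_hamiltonian ω₂ lam β γ N θ (n + 1)))).aestronglyMeasurable
  · rw [Real.norm_eq_abs]
    exact hK n s x
  · have hlim : Tendsto (fun n : ℕ => sdeGenerator (fun y => -P.drift N y) (P.bathVecL N T_L)
        (P.bathVecR N T_R) (fun y => smoothCutoff (Hm y / (n + 1)) * Real.exp (θ * Hm y)) x) atTop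
        (𝓝 (Real.exp (θ * Hm x) *
          (γ * (T_L * (θ ^ 2 * x.2 ⟨0, hN⟩ ^ 2 + θ) + θ * x.2 ⟨0, hN⟩ ^ 2 +
            (T_R * (θ ^ 2 * x.2 ⟨N - 1, by omega⟩ ^ 2 + θ) + θ * x.2 ⟨N - 1, by omega⟩ ^ 2))))) := by
      refine tendsto_const_nhds.congr' ?_
      obtain ⟨n₀, hn₀⟩ := exists_nat_ge (Hm x)
      filter_upwards [eventually_ge_atTop n₀] with n hn
      have hR : (0 : ℝ) < n + 1 := by positivity
      have hlt : Hm x < n + 1 := by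
        calc Hm x ≤ n₀ := hn₀
          _ ≤ n := by exact_mod_cast hn
          _ < n + 1 := lt_add_one _
      rw [hGn n x, deriv_cutoffExp_of_lt θ hR hlt, deriv_deriv_cutoffExp_of_lt θ hR hlt,
        show P.γ = γ from rfl]
      ring
    exact (pinnedChain_tendsto_integral_cutoff_kernel hω hl hβ hγ hN hTL hTR hϑ hϑ' hφc hφ s x).mul hlim

end Limits

end Summit.AtomisticToContinuum.FouriersLaw.Theorems

end
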